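import Summits.ABC.IUTFork.Cor312GenuineKTwistExactTriple
import Summits.ABC.IUTFork.Cor312GenuineKCyclotomicLowerBound
import Summits.ABC.IUTFork.Conditional.WRowFrey31117999167337103924704Packages
import Summits.ABC.IUTFork.Conditional.AbcOfSGenuineKLinUniformRows6
import HarnessLib

/-!
# R-W «W:INH-BANDS-REFUTED-SIDE», packages of the OVERLAP triple `2⁴⁶·23 + 3⁹·5⁵·11⁷·31²·43 = 19¹¹·59·7207`: the bad primes, the pole orders of `j`,
# and the LOWER local-type classes `E₀(p)·l ∣ e(K_x/ℚ_p)` at every bad fibre point (incl. the TWIST class `30·l` at `19, 59, 7207 ∣ c`)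

PROOF-ONLY file (D-0012; 0 definitions, 0 `Prop` facts, no instance) of the abc-iut cell — D-0079 RESCUE sub-cell R-W «WINDOW Θ-SIDE INEQUALITY»,
seat abc-iut-W-neg-1 (gen 4), row «W:INH-BANDS-REFUTED-SIDE» (abc-iut-plan C-R99 (b): the INHABITED twin of this seat's refuted bands p497967 /
p498239 / p501634 for the second OVERLAP triple). Pattern of this seat's `WRowFrey31117999167337103924704Packages` (p503576), for the triple
`a = 2⁴⁶·23`, `b = 3⁹·5⁵·11⁷·31²·43`, `c = 19¹¹·59·7207`. TAKES NO SIDE on [IUTchIII] Cor. 3.12 (S. Mochizuki, *Inter-universal Teichmüller theory III*,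
Cor. 3.12 p. 173–174) or on any author.

* §1 `WRow.prime_eq_of_dvd_frey1618481116086272` (a prime divisor of `abc` is one of `2, 3, 5, 11, 19, 23, 31, 43, 59, 7207`),
  `WRow.factorization_frey1618481116086272` (`v_p(abc)` at the nine odd primes), **`WRow.bad_prime_frey1618481116086272`** (a bad fibre point `x ∣ p`
  forces `p ∤ 2l`, `p ∣ abc`, `p` in the odd list, `ord_p j(a/c) = −2·v_p(abc)`; poles over primes of `abc` by `WRow.dvd_abc_of_ord_jInv_neg_triple`, p503576).
* §2 **`WRow.dvd_absRamificationIdx_frey1618481116086272`** — at every fibre point `x ∣ p` (`p ≠ l`) the LOWER class BY NAME: `10·l` over `3` (`v = 9`: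
  `30·l ∣ 9e`, abc-iut-W-neg-2's `…thirty…mul_three`), `12·l` over `5` (`v = 5`: `60·l ∣ 5e`, `…sixty…mul_five`), `15·l` over `11, 23, 31, 43`
  (`v = 7, 1, 2, 1` coprime to `15`: `…fifteen…ratPoint_of_coprime`), **`30·l` over `19, 59, 7207`** (`∥ c` resp. `19¹¹ ∥ c`, odd multiplicity: the TWIST class,
  `GenuineK.two_mul_prime_dvd_absRamificationIdx_kOf_triple_of_odd` p500830 with `15·l ∣ e`).
HONEST FRAMING: bookkeeping over OUR typed objects; nothing here bears on the printed inequality of [IUTchIII] Cor. 3.12; typed ≠ proved; no abc claim.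
[cite: SilvermanATAEC1994, V.5 Thm. 5.3 and Cor. 5.4] [cite: SilvermanAEC2009, Prop. III.1.7(b)] [cite: Mochizuki2012, IUTchI Def. 3.1 (b),(c) p. 61, Ex. 3.2 (iv) p. 71; IUTchIV Cor. 2.2 (ii) proof (P5) p. 46]
[claim: Mochizuki2012, status: disputed] for every IUT quotation.
-/

noncomputable section

open NumberField IsDedekindDomain

namespace Summit.ABC.IUTFork.Conditional

open Thm311 Thm311.Real Cor312 Cor312Prov Literature.IUT.LogVolume Literature.IUT.LogVolume.Cor22 Literature.IUT.HodgeTheaters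
  Literature.IUT.LogThetaLattice Literature.NumberTheory.NumberFields Literature.NumberTheory.DiophantineGeometry.GenEll
  Literature.NumberTheory.DiophantineGeometry

/-! ## §1. The bad primes and the pole orders -/

/-- `v_p(n) = k` from `n = p^k·m` with `p ∤ m`. [folklore] -/
private theorem factorization_eq_of_eq_pow_mul'' {p k m n : ℕ} (hp : p.Prime) (hn : n = p ^ k * m) (hm : ¬ p ∣ m) :
    n.factorization p = k := by
  subst hn
  have hm0 : m ≠ 0 := fun h => hm (h ▸ dvd_zero p)
  rw [Nat.factorization_mul (pow_ne_zero _ hp.ne_zero) hm0, Finsupp.add_apply, hp.factorization_pow, Finsupp.single_eq_same,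
    Nat.factorization_eq_zero_of_not_dvd hm, add_zero]

/-- A prime `q` dividing `p^k` (`p` prime) equals `p`. [folklore] -/
private theorem eq_of_prime_dvd_prime_pow' {q p k : ℕ} (hq : q.Prime) (hp : p.Prime) (h : q ∣ p ^ k) : q = p :=
  (Nat.prime_dvd_prime_iff_eq hq hp).mp (hq.dvd_of_dvd_pow h)

/-- **The prime divisors of `abc`** for `a = 2⁴⁶·23`, `b = 3⁹·5⁵·11⁷·31²·43`, `c = 19¹¹·59·7207`. [folklore] -/
theorem WRow.prime_eq_of_dvd_frey1618481116086272 {p : ℕ} (hp : p.Prime)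
    (h : p ∣ 2 ^ 46 * 23 * (3 ^ 9 * 5 ^ 5 * 11 ^ 7 * 31 ^ 2 * 43) * (19 ^ 11 * 59 * 7207)) :
    p = 2 ∨ p = 3 ∨ p = 5 ∨ p = 11 ∨ p = 19 ∨ p = 23 ∨ p = 31 ∨ p = 43 ∨ p = 59 ∨ p = 7207 := by
  have P2 : Nat.Prime 2 := by norm_num
  have P3 : Nat.Prime 3 := by norm_num
  have P5 : Nat.Prime 5 := by norm_num
  have P11 : Nat.Prime 11 := by norm_num
  have P19 : Nat.Prime 19 := by norm_num
  have P23 : Nat.Prime 23 := by norm_num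
  have P31 : Nat.Prime 31 := by norm_num
  have P43 : Nat.Prime 43 := by norm_num
  have P59 : Nat.Prime 59 := by norm_num
  have P7207 : Nat.Prime 7207 := by norm_num
  rcases (Nat.Prime.dvd_mul hp).mp h with h | h
  · rcases (Nat.Prime.dvd_mul hp).mp h with h | h
    · -- `p ∣ a = 2⁴⁶·23`
      rcases (Nat.Prime.dvd_mul hp).mp h with h | h
      · exact Or.inl (eq_of_prime_dvd_prime_pow' hp P2 h)
      · exact Or.inr (Or.inr (Or.inr (Or.inr (Or.inr (Or.inl ((Nat.prime_dvd_prime_iff_eq hp P23).mp h))))))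
    · -- `p ∣ b = 3⁹·5⁵·11⁷·31²·43`
      rcases (Nat.Prime.dvd_mul hp).mp h with h | h
      · rcases (Nat.Prime.dvd_mul hp).mp h with h | h
        · rcases (Nat.Prime.dvd_mul hp).mp h with h | h
          · rcases (Nat.Prime.dvd_mul hp).mp h with h | h
            · exact Or.inr (Or.inl (eq_of_prime_dvd_prime_pow' hp P3 h))
            · exact Or.inr (Or.inr (Or.inl (eq_of_prime_dvd_prime_pow' hp P5 h)))
          · exact Or.inr (Or.inr (Or.inr (Or.inl (eq_of_prime_dvd_prime_pow' hp P11 h))))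
        · exact Or.inr (Or.inr (Or.inr (Or.inr (Or.inr (Or.inr (Or.inl (eq_of_prime_dvd_prime_pow' hp P31 h)))))))
      · exact Or.inr (Or.inr (Or.inr (Or.inr (Or.inr (Or.inr (Or.inr (Or.inl ((Nat.prime_dvd_prime_iff_eq hp P43).mp h))))))))
  · -- `p ∣ c = 19¹¹·59·7207`
    rcases (Nat.Prime.dvd_mul hp).mp h with h | h
    · rcases (Nat.Prime.dvd_mul hp).mp h with h | h
      · exact Or.inr (Or.inr (Or.inr (Or.inr (Or.inl (eq_of_prime_dvd_prime_pow' hp P19 h)))))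
      · exact Or.inr (Or.inr (Or.inr (Or.inr (Or.inr (Or.inr (Or.inr (Or.inr (Or.inl ((Nat.prime_dvd_prime_iff_eq hp P59).mp h)))))))))
    · exact Or.inr (Or.inr (Or.inr (Or.inr (Or.inr (Or.inr (Or.inr (Or.inr (Or.inr ((Nat.prime_dvd_prime_iff_eq hp P7207).mp h)))))))))

/-- **`v_p(abc)` at the nine odd primes of `abc`**: `9, 5, 7, 11, 1, 2, 1, 1, 1` over `3, 5, 11, 19, 23, 31, 43, 59, 7207`. [folklore] -/
theorem WRow.factorization_frey1618481116086272 {p : ℕ}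
    (hp : p = 3 ∨ p = 5 ∨ p = 11 ∨ p = 19 ∨ p = 23 ∨ p = 31 ∨ p = 43 ∨ p = 59 ∨ p = 7207) :
    (2 ^ 46 * 23 * (3 ^ 9 * 5 ^ 5 * 11 ^ 7 * 31 ^ 2 * 43) * (19 ^ 11 * 59 * 7207)).factorization p =
      (if p = 3 then 9 else if p = 5 then 5 else if p = 11 then 7 else if p = 19 then 11 else if p = 23 then 1 else
        if p = 31 then 2 else if p = 43 then 1 else if p = 59 then 1 else 1) := by
  rcases hp with rfl | rfl | rfl | rfl | rfl | rfl | rfl | rfl | rfl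
  · exact factorization_eq_of_eq_pow_mul'' (k := 9) (m := 2 ^ 46 * 23 * (5 ^ 5 * 11 ^ 7 * 31 ^ 2 * 43) * (19 ^ 11 * 59 * 7207)) (by norm_num) (by ring) (by norm_num)
  · exact factorization_eq_of_eq_pow_mul'' (k := 5) (m := 2 ^ 46 * 23 * (3 ^ 9 * 11 ^ 7 * 31 ^ 2 * 43) * (19 ^ 11 * 59 * 7207)) (by norm_num) (by ring) (by norm_num)
  · exact factorization_eq_of_eq_pow_mul'' (k := 7) (m := 2 ^ 46 * 23 * (3 ^ 9 * 5 ^ 5 * 31 ^ 2 * 43) * (19 ^ 11 * 59 * 7207)) (by norm_num) (by ring) (by norm_num)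
  · exact factorization_eq_of_eq_pow_mul'' (k := 11) (m := 2 ^ 46 * 23 * (3 ^ 9 * 5 ^ 5 * 11 ^ 7 * 31 ^ 2 * 43) * (59 * 7207)) (by norm_num) (by ring) (by norm_num)
  · exact factorization_eq_of_eq_pow_mul'' (k := 1) (m := 2 ^ 46 * (3 ^ 9 * 5 ^ 5 * 11 ^ 7 * 31 ^ 2 * 43) * (19 ^ 11 * 59 * 7207)) (by norm_num) (by ring) (by norm_num)
  · exact factorization_eq_of_eq_pow_mul'' (k := 2) (m := 2 ^ 46 * 23 * (3 ^ 9 * 5 ^ 5 * 11 ^ 7 * 43) * (19 ^ 11 * 59 * 7207)) (by norm_num) (by ring) (by norm_num)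
  · exact factorization_eq_of_eq_pow_mul'' (k := 1) (m := 2 ^ 46 * 23 * (3 ^ 9 * 5 ^ 5 * 11 ^ 7 * 31 ^ 2) * (19 ^ 11 * 59 * 7207)) (by norm_num) (by ring) (by norm_num)
  · exact factorization_eq_of_eq_pow_mul'' (k := 1) (m := 2 ^ 46 * 23 * (3 ^ 9 * 5 ^ 5 * 11 ^ 7 * 31 ^ 2 * 43) * (19 ^ 11 * 7207)) (by norm_num) (by ring) (by norm_num)
  · exact factorization_eq_of_eq_pow_mul'' (k := 1) (m := 2 ^ 46 * 23 * (3 ^ 9 * 5 ^ 5 * 11 ^ 7 * 31 ^ 2 * 43) * (19 ^ 11 * 59)) (by norm_num) (by ring) (by norm_num)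

/-- **The bad fibre points of a genuine datum over `(ratPoint (a/c), l)` for the second OVERLAP triple**: a fibre point `x ∣ p` in the bad locus `S` of
`pilotDataOfK T.D T.K` has `p ≠ 2`, `p ≠ l` ([IUTchI] Def. 3.1 (b),(c): `Cor312Prov.ne_two_and_ne_l_of_placeOf_mem_S_pilotDataOfK`), **`p ∣ abc`**
(the chosen realising q-idele has norm `< 1` there, i.e. `j` has a pole below, `Cor312Prov.norm_chosenQIdele_lt_one` + `WRow.dvd_abc_of_ord_jInv_neg_triple`),
hence `p ∈ {3, 5, 11, 19, 23, 31, 43, 59, 7207}`, and `ord_p j(a/c) = −2·v_p(abc)` at the place below `x` (`Cor22.ord_jInv_ratPoint_triple_eq`).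
[cite: Mochizuki2012, IUTchI Def. 3.1 (b),(c) p. 61; IUTchIV Cor. 2.2 (ii) proof (P5) p. 46] [claim: Mochizuki2012, status: disputed] -/
theorem WRow.bad_prime_frey1618481116086272 {l : ℕ}
    (T : Cor22.ThetaVolumeDatumAt (ratPoint (((2 ^ 46 * 23 : ℕ) : ℚ) / (19 ^ 11 * 59 * 7207 : ℕ))) l) (pp : Nat.Primes) :
    letI := T.instFieldF; letI := T.instNumberFieldF; letI := T.instAlgebraF; letI := T.instFieldK
    letI := T.instNumberFieldK; letI := T.instAlgebraK; letI := T.instFieldFbar; letI := T.instAlgebraFbar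
    letI := T.instAlgebraKFbar; letI := T.instIsElliptic
    haveI : Fact (pp : ℕ).Prime := ⟨pp.2⟩
    ∀ x : (thetaIndex (pilotDataOfK T.D T.K)).Fibre (.inr pp), placeOf (pilotDataOfK T.D T.K) pp.1 x ∈ (pilotDataOfK T.D T.K).S →
      (pp : ℕ) ≠ 2 ∧ (pp : ℕ) ≠ l ∧ (pp : ℕ) ∣ 2 ^ 46 * 23 * (3 ^ 9 * 5 ^ 5 * 11 ^ 7 * 31 ^ 2 * 43) * (19 ^ 11 * 59 * 7207) ∧
      ((pp : ℕ) = 3 ∨ (pp : ℕ) = 5 ∨ (pp : ℕ) = 11 ∨ (pp : ℕ) = 19 ∨ (pp : ℕ) = 23 ∨ (pp : ℕ) = 31 ∨ (pp : ℕ) = 43 ∨ (pp : ℕ) = 59 ∨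
        (pp : ℕ) = 7207) ∧
      ord ℚ (finBelow ℚ T.K (placeOf (pilotDataOfK T.D T.K) pp.1 x))
          (jInv (((2 ^ 46 * 23 : ℕ) : ℚ) / (19 ^ 11 * 59 * 7207 : ℕ))) =
        -(2 * (((2 ^ 46 * 23 * (3 ^ 9 * 5 ^ 5 * 11 ^ 7 * 31 ^ 2 * 43) * (19 ^ 11 * 59 * 7207)).factorization pp : ℕ) : ℤ)) := by
  letI := T.instFieldF; letI := T.instNumberFieldF; letI := T.instAlgebraF; letI := T.instFieldK
  letI := T.instNumberFieldK; letI := T.instAlgebraK; letI := T.instFieldFbar; letI := T.instAlgebraFbar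
  letI := T.instAlgebraKFbar; letI := T.instIsElliptic
  haveI : Fact (pp : ℕ).Prime := ⟨pp.2⟩
  intro x hx
  have habc := isABCTriple_frey1618481116086272
  have hjF : T.E.j = ((jInv (((2 ^ 46 * 23 : ℕ) : ℚ) / (19 ^ 11 * 59 * 7207 : ℕ)) : ℚ) : T.F) := by
    rw [T.j_eq]; exact eq_ratCast _ _
  have hp1 : (1 : ℝ) < ((pp : ℕ) : ℝ) := by exact_mod_cast pp.2.one_lt
  have hgen := natGenerator_finBelow_placeOf T.D pp x
  -- a pole of `j` under the bad place (adapted from abc-iut-W-row-1's `WRow.bad_prime_frey283`)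
  have hneg : ord ℚ (finBelow ℚ T.K (placeOf (pilotDataOfK T.D T.K) pp.1 x))
      (jInv (((2 ^ 46 * 23 : ℕ) : ℚ) / (19 ^ 11 * 59 * 7207 : ℕ))) < 0 := by
    have hlt := norm_chosenQIdele_lt_one T.D pp x hx
    rw [norm_chosenQIdele_eq_rpow_ord_rat' T.D pp x hx _ hjF] at hlt
    by_contra hge
    push Not at hge
    have hl : (0 : ℝ) < 2 * (l : ℕ) := by
      have : 0 < l := lt_of_lt_of_le (by norm_num) T.D.five_le_l
      positivity
    have hexp : (0 : ℝ) ≤ (ord ℚ (finBelow ℚ T.K (placeOf (pilotDataOfK T.D T.K) pp.1 x))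
        (jInv (((2 ^ 46 * 23 : ℕ) : ℚ) / (19 ^ 11 * 59 * 7207 : ℕ))) : ℝ) / (2 * (l : ℕ)) :=
      div_nonneg (by exact_mod_cast hge) hl.le
    have h1 := (Real.rpow_le_rpow_left_iff hp1).mpr hexp
    rw [Real.rpow_zero] at h1
    linarith
  obtain ⟨h2, hl'⟩ := ne_two_and_ne_l_of_placeOf_mem_S_pilotDataOfK T.D pp x hx
  have hdvd : (pp : ℕ) ∣ 2 ^ 46 * 23 * (3 ^ 9 * 5 ^ 5 * 11 ^ 7 * 31 ^ 2 * 43) * (19 ^ 11 * 59 * 7207) := by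
    have h := WRow.dvd_abc_of_ord_jInv_neg_triple habc _ hneg
    rw [hgen] at h
    exact h
  have hmem := WRow.prime_eq_of_dvd_frey1618481116086272 pp.2 hdvd
  refine ⟨h2, hl', hdvd, ?_, ?_⟩
  · rcases hmem with h | h
    · exact absurd h h2
    · exact h
  · rw [Cor22.ord_jInv_ratPoint_triple_eq habc _ (by rw [hgen]; exact h2) (by rw [hgen]; exact hdvd), hgen]

/-! ## §2. The LOWER local-type classes at the bad fibre -/

/-- **`E₀(p)·l ∣ e(K_x/ℚ_p)` at every fibre point `x ∣ p` (`p ≠ l`) of a genuine datum over the second OVERLAP triple**, BY NAME: `10·l` over `3`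
(`30·l ∣ 9·e`: abc-iut-W-neg-2's `GenuineK.thirty_mul_prime_dvd_absRamificationIdx_kOf_mul_three`), `12·l` over `5` (`60·l ∣ 5·e`, `…sixty…mul_five`),
`15·l` over `11, 23, 31, 43` (`v` coprime to `15`), **`30·l` over `19, 59, 7207`** (odd multiplicity in `c`: the TWIST class, p500830, with `15·l ∣ e`).
[cite: SilvermanATAEC1994, V.5 Thm. 5.3 and Cor. 5.4] [cite: Mochizuki2012, IUTchI Ex. 3.2 (iv) p. 71] [claim: Mochizuki2012, status: disputed] -/
theorem WRow.dvd_absRamificationIdx_frey1618481116086272 {l : ℕ}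
    (T : Cor22.ThetaVolumeDatumAt (ratPoint (((2 ^ 46 * 23 : ℕ) : ℚ) / (19 ^ 11 * 59 * 7207 : ℕ))) l)
    (pp : Nat.Primes) (hpl : (pp : ℕ) ≠ l) :
    letI := T.instFieldF; letI := T.instNumberFieldF; letI := T.instAlgebraF; letI := T.instFieldK
    letI := T.instNumberFieldK; letI := T.instAlgebraK; letI := T.instFieldFbar; letI := T.instAlgebraFbar
    letI := T.instAlgebraKFbar; letI := T.instIsElliptic
    haveI : Fact (pp : ℕ).Prime := ⟨pp.2⟩
    ∀ x : (thetaIndex (pilotDataOfK T.D T.K)).Fibre (.inr pp),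
      ((pp : ℕ) = 3 → 10 * l ∣ absRamificationIdx (pp : ℕ) (kOf (pilotDataOfK T.D T.K) pp.1 x)) ∧
      ((pp : ℕ) = 5 → 12 * l ∣ absRamificationIdx (pp : ℕ) (kOf (pilotDataOfK T.D T.K) pp.1 x)) ∧
      ((pp : ℕ) = 11 → 15 * l ∣ absRamificationIdx (pp : ℕ) (kOf (pilotDataOfK T.D T.K) pp.1 x)) ∧
      ((pp : ℕ) = 19 → 30 * l ∣ absRamificationIdx (pp : ℕ) (kOf (pilotDataOfK T.D T.K) pp.1 x)) ∧
      ((pp : ℕ) = 23 → 15 * l ∣ absRamificationIdx (pp : ℕ) (kOf (pilotDataOfK T.D T.K) pp.1 x)) ∧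
      ((pp : ℕ) = 31 → 15 * l ∣ absRamificationIdx (pp : ℕ) (kOf (pilotDataOfK T.D T.K) pp.1 x)) ∧
      ((pp : ℕ) = 43 → 15 * l ∣ absRamificationIdx (pp : ℕ) (kOf (pilotDataOfK T.D T.K) pp.1 x)) ∧
      ((pp : ℕ) = 59 → 30 * l ∣ absRamificationIdx (pp : ℕ) (kOf (pilotDataOfK T.D T.K) pp.1 x)) ∧
      ((pp : ℕ) = 7207 → 30 * l ∣ absRamificationIdx (pp : ℕ) (kOf (pilotDataOfK T.D T.K) pp.1 x)) := by
  letI := T.instFieldF; letI := T.instNumberFieldF; letI := T.instAlgebraF; letI := T.instFieldK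
  letI := T.instNumberFieldK; letI := T.instAlgebraK; letI := T.instFieldFbar; letI := T.instAlgebraFbar
  letI := T.instAlgebraKFbar; letI := T.instIsElliptic
  haveI : Fact (pp : ℕ).Prime := ⟨pp.2⟩
  intro x
  have habc := isABCTriple_frey1618481116086272
  have hl5 : 5 ≤ l := T.D.five_le_l
  have hlP : l.Prime := T.D.l_prime
  have hpole : ∀ {p₀ : ℕ} (hp₀ : p₀ = 3 ∨ p₀ = 5 ∨ p₀ = 11 ∨ p₀ = 19 ∨ p₀ = 23 ∨ p₀ = 31 ∨ p₀ = 43 ∨ p₀ = 59 ∨ p₀ = 7207),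
      ∀ v : HeightOneSpectrum (𝓞 ℚ), Rat.HeightOneSpectrum.natGenerator v = p₀ →
        ord ℚ v (jInv (((2 ^ 46 * 23 : ℕ) : ℚ) / (19 ^ 11 * 59 * 7207 : ℕ))) =
          -(2 * ((if p₀ = 3 then 9 else if p₀ = 5 then 5 else if p₀ = 11 then 7 else if p₀ = 19 then 11 else if p₀ = 23 then 1 else
            if p₀ = 31 then 2 else if p₀ = 43 then 1 else if p₀ = 59 then 1 else 1 : ℕ) : ℤ)) := by
    intro p₀ hp₀ v hv
    have hp2 : Rat.HeightOneSpectrum.natGenerator v ≠ 2 := by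
      rw [hv]; rcases hp₀ with rfl | rfl | rfl | rfl | rfl | rfl | rfl | rfl | rfl <;> norm_num
    have hdvd : Rat.HeightOneSpectrum.natGenerator v ∣ 2 ^ 46 * 23 * (3 ^ 9 * 5 ^ 5 * 11 ^ 7 * 31 ^ 2 * 43) * (19 ^ 11 * 59 * 7207) := by
      rw [hv]; rcases hp₀ with rfl | rfl | rfl | rfl | rfl | rfl | rfl | rfl | rfl <;> norm_num
    rw [Cor22.ord_jInv_ratPoint_triple_eq habc v hp2 hdvd, hv, WRow.factorization_frey1618481116086272 hp₀]
  refine ⟨fun hp => ?_, fun hp => ?_, fun hp => ?_, fun hp => ?_, fun hp => ?_, fun hp => ?_, fun hp => ?_, fun hp => ?_, fun hp => ?_⟩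
  · -- `3⁹ ∥ b`: `30·l ∣ 9·e` ⇒ `10·l ∣ e`
    have hpp : pp = ⟨3, Nat.prime_three⟩ := Subtype.ext hp
    subst hpp
    have h30 := GenuineK.thirty_mul_prime_dvd_absRamificationIdx_kOf_mul_three T (fun h => hpl h.symm) (t := 9) (by norm_num)
      (fun v hv => by rw [hpole (Or.inl rfl) v hv]; norm_num) x
    have h10 : 10 * l * 3 ∣ absRamificationIdx 3 (kOf (pilotDataOfK T.D T.K) 3 x) * 3 * 3 := by
      rw [show 10 * l * 3 = 30 * l by ring, show absRamificationIdx 3 (kOf (pilotDataOfK T.D T.K) 3 x) * 3 * 3 =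
        absRamificationIdx 3 (kOf (pilotDataOfK T.D T.K) 3 x) * 9 by ring]; exact h30
    have h10' := Nat.dvd_of_mul_dvd_mul_right (by norm_num : 0 < 3) h10
    have hcop : Nat.Coprime (10 * l) 3 := by
      have hl3 : l ≠ 3 := fun h => hpl (by simpa using h.symm)
      exact Nat.Coprime.mul_left (by norm_num) ((Nat.coprime_primes hlP Nat.prime_three).mpr hl3)
    exact hcop.dvd_of_dvd_mul_right h10'
  · -- `5⁵ ∥ b`: `60·l ∣ 5·e` ⇒ `12·l ∣ e`
    have hpp : pp = ⟨5, Nat.prime_five⟩ := Subtype.ext hp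
    subst hpp
    have h60 := GenuineK.sixty_mul_prime_dvd_absRamificationIdx_kOf_mul_five T (fun h => hpl h.symm) (t := 5) (by norm_num)
      (fun v hv => by rw [hpole (Or.inr (Or.inl rfl)) v hv]; norm_num) x
    have : 12 * l * 5 ∣ absRamificationIdx 5 (kOf (pilotDataOfK T.D T.K) 5 x) * 5 := by
      rw [show 12 * l * 5 = 60 * l by ring]; exact h60
    exact Nat.dvd_of_mul_dvd_mul_right (by norm_num) this
  · exact GenuineK.fifteen_mul_prime_dvd_absRamificationIdx_kOf_ratPoint_of_coprime T pp (by rw [hp]; norm_num) hpl (t := 7)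
      (by norm_num) (by decide) (fun v hv => by rw [hpole (Or.inr (Or.inr (Or.inl hp))) v hv, hp]; norm_num) x
  · -- `19 ∣ c`, odd multiplicity: twist `2·l ∣ e` and `15·l ∣ e`
    have h2 := GenuineK.two_mul_prime_dvd_absRamificationIdx_kOf_triple_of_odd habc T pp (by rw [hp]; norm_num) hpl
      (by rw [hp]; norm_num) (by
        have : (19 ^ 11 * 59 * 7207).factorization (pp : ℕ) = 11 := by
          rw [hp]; exact factorization_eq_of_eq_pow_mul'' (k := 11) (m := 59 * 7207) (by norm_num) (by ring) (by norm_num)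
        rw [this]; decide) x
    have h15 := GenuineK.fifteen_mul_prime_dvd_absRamificationIdx_kOf_ratPoint_of_coprime T pp (by rw [hp]; norm_num) hpl (t := 11)
      (by norm_num) (by decide) (fun v hv => by rw [hpole (Or.inr (Or.inr (Or.inr (Or.inl hp)))) v hv, hp]; norm_num) x
    have hcop : Nat.Coprime 2 (15 * l) := by
      have hl2 : l ≠ 2 := by omega
      exact Nat.Coprime.mul_right (by norm_num) ((Nat.coprime_primes Nat.prime_two hlP).mpr hl2.symm)
    have := Nat.Coprime.mul_dvd_of_dvd_of_dvd hcop (dvd_trans (dvd_mul_right 2 l) h2) h15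
    rwa [show 2 * (15 * l) = 30 * l by ring] at this
  · exact GenuineK.fifteen_mul_prime_dvd_absRamificationIdx_kOf_ratPoint_of_coprime T pp (by rw [hp]; norm_num) hpl (t := 1)
      (by norm_num) (by decide) (fun v hv => by rw [hpole (Or.inr (Or.inr (Or.inr (Or.inr (Or.inl hp))))) v hv, hp]; norm_num) x
  · exact GenuineK.fifteen_mul_prime_dvd_absRamificationIdx_kOf_ratPoint_of_coprime T pp (by rw [hp]; norm_num) hpl (t := 2)
      (by norm_num) (by decide) (fun v hv => by rw [hpole (Or.inr (Or.inr (Or.inr (Or.inr (Or.inr (Or.inl hp)))))) v hv, hp]; norm_num) x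
  · exact GenuineK.fifteen_mul_prime_dvd_absRamificationIdx_kOf_ratPoint_of_coprime T pp (by rw [hp]; norm_num) hpl (t := 1)
      (by norm_num) (by decide) (fun v hv => by rw [hpole (Or.inr (Or.inr (Or.inr (Or.inr (Or.inr (Or.inr (Or.inl hp))))))) v hv, hp]; norm_num) x
  · -- `59 ∣ c`, odd multiplicity: twist `2·l ∣ e` and `15·l ∣ e`
    have h2 := GenuineK.two_mul_prime_dvd_absRamificationIdx_kOf_triple_of_odd habc T pp (by rw [hp]; norm_num) hpl
      (by rw [hp]; norm_num) (by
        have : (19 ^ 11 * 59 * 7207).factorization (pp : ℕ) = 1 := by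
          rw [hp]; exact factorization_eq_of_eq_pow_mul'' (k := 1) (m := 19 ^ 11 * 7207) (by norm_num) (by ring) (by norm_num)
        rw [this]; decide) x
    have h15 := GenuineK.fifteen_mul_prime_dvd_absRamificationIdx_kOf_ratPoint_of_coprime T pp (by rw [hp]; norm_num) hpl (t := 1)
      (by norm_num) (by decide) (fun v hv => by rw [hpole (Or.inr (Or.inr (Or.inr (Or.inr (Or.inr (Or.inr (Or.inr (Or.inl hp)))))))) v hv, hp]; norm_num) x
    have hcop : Nat.Coprime 2 (15 * l) := by
      have hl2 : l ≠ 2 := by omega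
      exact Nat.Coprime.mul_right (by norm_num) ((Nat.coprime_primes Nat.prime_two hlP).mpr hl2.symm)
    have := Nat.Coprime.mul_dvd_of_dvd_of_dvd hcop (dvd_trans (dvd_mul_right 2 l) h2) h15
    rwa [show 2 * (15 * l) = 30 * l by ring] at this
  · -- `7207 ∣ c`, odd multiplicity: twist `2·l ∣ e` and `15·l ∣ e`
    have h2 := GenuineK.two_mul_prime_dvd_absRamificationIdx_kOf_triple_of_odd habc T pp (by rw [hp]; norm_num) hpl
      (by rw [hp]; norm_num) (by
        have : (19 ^ 11 * 59 * 7207).factorization (pp : ℕ) = 1 := by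
          rw [hp]; exact factorization_eq_of_eq_pow_mul'' (k := 1) (m := 19 ^ 11 * 59) (by norm_num) (by ring) (by norm_num)
        rw [this]; decide) x
    have h15 := GenuineK.fifteen_mul_prime_dvd_absRamificationIdx_kOf_ratPoint_of_coprime T pp (by rw [hp]; norm_num) hpl (t := 1)
      (by norm_num) (by decide) (fun v hv => by rw [hpole (Or.inr (Or.inr (Or.inr (Or.inr (Or.inr (Or.inr (Or.inr (Or.inr hp)))))))) v hv, hp]; norm_num) x
    have hcop : Nat.Coprime 2 (15 * l) := by
      have hl2 : l ≠ 2 := by omega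
      exact Nat.Coprime.mul_right (by norm_num) ((Nat.coprime_primes Nat.prime_two hlP).mpr hl2.symm)
    have := Nat.Coprime.mul_dvd_of_dvd_of_dvd hcop (dvd_trans (dvd_mul_right 2 l) h2) h15
    rwa [show 2 * (15 * l) = 30 * l by ring] at this

end Summit.ABC.IUTFork.Conditional

end
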